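import Summits.QuantumFields.BalabanUV.Beta.WilsonStencilDivergence
import Summits.QuantumFields.BalabanUV.Beta.WilsonReflectionContact
import Summits.QuantumFields.BalabanUV.Beta.WardLocusS0N

/-!
# The WARD (divergence) law of an2's antisymmetric Wilson table `wilsonA` on `ℤ^(d+1)`, in `divV` / `conjV` form, and the block stencil
# Ward socket `hSd` of the hW root at `j = 0`

HONEST FRAMING (cell charter, verbatim): «discharging `BetaPertH` makes Bałaban's UV stability UNCONDITIONAL — a real
constructive-QFT result; it is NOT the continuum limit and NOT the Clay problem.»  DERIVED cell leaf (pub-balaban β sub-cell, D1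
formalisation swarm seat `b2b-balaban-beta-d1-formalise-leaf-05`, gen 2; leaf (W-LS0-E) «the Wilson Ward law» of an1-g25's hW skeleton
`HOME/b2b-balaban-beta-an1-g25/SKELETON-D1-hW.v1.md` §2 (W-LS)_0, stage 3 of 3 = the law on `ℤ^(d+1)` and the socket it discharges): finite
algebra, no estimate, no limit, nothing cited — every statement is kernel-proved ([folklore] = standard finite algebra); no `[cite:]` tag, no
`def … : Prop`; by itself it instantiates NO binder of the β-function wall.  NOT `BetaPertH`, NOT continuum, NOT Clay.
HONEST DEPENDENCY (cell records, verbatim): «continuum YM on T⁴ ⇐ BetaPertH ∧ nine spine estimates (0/9 proved); BetaPertH ⇐ (D1) ∧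
(D4) ∧ CAP+tail; G-an2-4 gates asym, D1 and NE2/3/4.»
ABSOLUTE RULE (cell charter, verbatim): «No internally-minted statement may enter as a cited fact. Every hypothesis is either
kernel-proved in this package or a verbatim quotation of a PUBLISHED theorem with page reference. The manuscript(s) under audit are
NOT citable for their own disputed steps — they are the thing under adjudication; programme-internal (2001/route/tribunal) claims are
never citable.»

THE STATEMENT (`divV_wilsonA_eq_conjV`).  For every dimension `d`, every root `ρ`, every window parameter `L` and every site `u` of
`ℤ^(d+1)`:

  **`divV (wilsonA d) u = (1/2 : ℝ) • conjV (ffK (bhKAt d ρ L)) (diagK (legInd ρ u))`**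

(`KernelWard.divV`, `ChartConjugation.conjV`, `BorderedHessian.diagK` / `bhKAt`, `WardLocusStencils.ffK`, `AveragingWardRootedStencils.legInd`):
the response of an2's colourless Wilson cubic stencil `StepJetData.wilsonA` to the pure-gauge background `d(δ_u)` is ONE HALF of the
commutator of the field–field block `d*d` of the bordered Hessian with the generator of the gauge rotation at `u` — entrywise
(`divV_wilsonA_inl_inl`): `Σ_γ (wilsonA γ (u − e_γ) − wilsonA γ u) x z (inl a) (inl b) = ½ · (d*d δ_{(b,z)})_a(x) · ([z = u] − [x = u])`.
THIS IS VERBATIM THE SOCKET `hW` of leaf-10's `WardLocusS0N.hSd_S0NAt_of_wilsonWard` with the constant `cE' = 1/2` that its lock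
`WardLocusS0N.lock_at_units_fold` demands at the hR units fold `(cE, cVH) = (2, −Lc^{d+1})`; §4 plugs it: **`hSd_S0NAt_units_fold`** — the
block stencil Ward socket `hSd` of the hW root (`KernelWardRelative.wardTransversal_flipK_hessKer_conj_rel` /
`SpineRooted.wardTransversal_flipK_TbalOf_JsBalBmNAtOf_ctrC_kernel`) HOLDS at `j = 0` for the rooted native spine `S0NAt ρ 2 (−Lc^{d+1}) cΛ`,
`𝕄₀ = bhKAt d ρ Lc`, generator `ξ • Σ_v legInd ρ (Lc•y + v)`, with `cH = ξ` (every `ξ`, `cΛ`, in-block root).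

THE PROOF.  (1) `wilsonA`'s field block is an3's antisymmetrised colourless stencil `WilsonReflectionFrame.S₀A` read with the frame
`B6BondElimination.unitVec` (`WilsonReflectionContact.wilsonA_inl_inl`).  (2) The finite-lattice law `WilsonStencilDivergence.S₀A_div` is
instantiated on the torus `(ZMod M)^(d+1)` with the reduced frame `castVec M ∘ unitVec` (`torus_law`) and pulled back to `ℤ^(d+1)` along
`WilsonStencilTransport.castVec (dmod + 1)`, injective on the finite window of sites that occur (`castVec_injOn`, `S₀A_map`, `Lc_map`):
`S₀A_div_Z`.  (3) The contact coefficient is half the `d*d` matrix entry (`WilsonReflectionContact.curvAdj_curv_delta1_eq_two_mul_Lc`,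
`BorderedHessianSymmetry.curvAdj_curv_delta1_symm`), and an2's `conjV_diagK_apply` / leaf-10's `conjV_ffK_bhKAt_diagK_legInd_inl_inl` /
`BorderedHessianKernelAction.bhK_inl_inl_eq` bring the right side to `conjV` form; off the field–field block both sides vanish.
-/

namespace Summit.QuantumFields.BalabanUV.Beta.WilsonDivergenceContact

open Finset
open scoped BigOperators
open Literature.MathematicalPhysics.QuantumFieldTheory.Balaban1983to89
open Literature.MathematicalPhysics.QuantumFieldTheory.Balaban1983to89.Beta
open PlaquetteStencilData (WilsonIdx wα wβ)
open StepJetData (wilsonA)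
open ExpKernelCalculus (MKer)
open OneStepResolventKernel (Fib)
open KernelWard (divV)
open AffineAveraging (box toSite curv curvAdj)
open KKTFluctuationKernel (delta1)
open B6BondElimination (unitVec unitVec_apply)
open AveragingHessianKernelsRooted (vhSAt)
open Summit.QuantumFields.BalabanUV.Beta.ChartConjugation (conjV)
open Summit.QuantumFields.BalabanUV.Beta.BorderedHessian (diagK bhKAt bhK bhK_inl_inl_eq curvAdj_curv_delta1_symm conjV_diagK_apply)
open Summit.QuantumFields.BalabanUV.Beta.AveragingWardRootedStencils (legInd legInd_inl)
open Summit.QuantumFields.BalabanUV.Beta.WilsonReflectionFrame (Lc S₀A)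
open Summit.QuantumFields.BalabanUV.Beta.WilsonStencilTransport (castVec castVec_apply castVec_injOn S₀A_map Lc_map)
open Summit.QuantumFields.BalabanUV.Beta.WilsonReflectionContact (wilsonA_inl_inl wilsonA_inl_inr wilsonA_inr_inl wilsonA_inr_inr
  curvAdj_curv_delta1_eq_two_mul_Lc)
open Summit.QuantumFields.BalabanUV.Beta.WilsonStencilDivergence (S₀A_div)
open Summit.QuantumFields.BalabanUV.Beta.WardLocusStencils (ffK ffK_inl_inl ffK_inl_inr ffK_inr_inl ffK_inr_inr divV_apply
  conjV_ffK_bhKAt_diagK_legInd_inl_inl)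
open Summit.QuantumFields.BalabanUV.Beta.WardLocusS0N (conjV_diagK_sum hSd_S0NAt_of_wilsonWard)
open Summit.QuantumFields.BalabanUV.Beta.SpineRooted (S0NAt)

noncomputable section

variable {d : ℕ}

/-! ## §1 The torus instance of the finite-lattice law -/

section Torus

/-- [folklore] THE TORUS LAW: `WilsonStencilDivergence.S₀A_div` on `(ZMod M)^(d+1)` with the reduced frame `castVec M ∘ unitVec`. -/
theorem torus_law (M : ℕ) [NeZero M] (u : Fin (d + 1) → ZMod M) (p q : (Fin (d + 1) → ZMod M) × Fin (d + 1)) :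
    (∑ γ, (S₀A (⇑(castVec M) ∘ unitVec) (u - (⇑(castVec M) ∘ unitVec) γ) γ p q - S₀A (⇑(castVec M) ∘ unitVec) u γ p q)) =
      ((if q.1 = u then 1 else 0) - (if p.1 = u then 1 else 0)) * Lc (⇑(castVec M) ∘ unitVec) q.2 q.1 p :=
  S₀A_div _ u p q

end Torus

/-! ## §2 The finite window of sites and the transfer to `ℤ^(d+1)` -/

section Transfer

/-- index type of the finite family of sites entering the transfer.  A definition asserting nothing. [folklore] -/
abbrev DIdx (d : ℕ) : Type :=
  ((Bool × Bool) ⊕ ((Fin (d + 1) × (Bool × Bool)) × WilsonIdx (Fin (d + 1)))) ⊕ ((Fin (d + 1) × Fin (d + 1)) ⊕ (Bool × Fin (d + 1)))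

/-- THE FINITE FAMILY OF SITES entering the transfer of the law for the legs `(x,a), (z,b)` and the varied site `u`: the legs, `u` (twice), the
stencil supports around `u − e_γ` and around `u` for every direction `γ`, and the sites `z − e_ν + e_μ`, `z − e_ν`, `z + e_μ` read by the contact
coefficient.  A definition asserting nothing. [folklore] -/
def dpts (u x z : Fin (d + 1) → ℤ) : DIdx d → (Fin (d + 1) → ℤ)
  | Sum.inl (Sum.inl (true, true)) => x
  | Sum.inl (Sum.inl (true, false)) => z
  | Sum.inl (Sum.inl (false, _)) => u
  | Sum.inl (Sum.inr ((γ, (true, true)), i)) => u - unitVec γ + wα unitVec γ i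
  | Sum.inl (Sum.inr ((γ, (true, false)), i)) => u - unitVec γ + wβ unitVec γ i
  | Sum.inl (Sum.inr ((γ, (false, true)), i)) => u + wα unitVec γ i
  | Sum.inl (Sum.inr ((γ, (false, false)), i)) => u + wβ unitVec γ i
  | Sum.inr (Sum.inl νμ) => z - unitVec νμ.1 + unitVec νμ.2
  | Sum.inr (Sum.inr (true, ν)) => z - unitVec ν
  | Sum.inr (Sum.inr (false, μ)) => z + unitVec μ

/-- THE MODULUS of the transfer torus: the sum of all coordinate differences of the family (one is added when used).  A definition asserting
nothing. [folklore] -/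
def dmod (u x z : Fin (d + 1) → ℤ) : ℕ :=
  ∑ i, ∑ i', ∑ j, (dpts u x z i j - dpts u x z i' j).natAbs

/-- **THE WARD (DIVERGENCE) LAW OF THE ANTISYMMETRISED COLOURLESS WILSON STENCIL ON `ℤ^(d+1)`** (frame `B6BondElimination.unitVec`):
`Σ_γ (S₀A(u − e_γ, γ; (x,a), (z,b)) − S₀A(u, γ; (x,a), (z,b))) = ([z = u] − [x = u]) · Lc unitVec b z (x, a)` — the torus law pulled back along
`castVec (dmod + 1)`. [folklore] -/
theorem S₀A_div_Z (u x z : Fin (d + 1) → ℤ) (a b : Fin (d + 1)) :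
    (∑ γ, (S₀A unitVec (u - unitVec γ) γ (x, a) (z, b) - S₀A unitVec u γ (x, a) (z, b))) =
      ((if z = u then 1 else 0) - (if x = u then 1 else 0)) * Lc unitVec b z (x, a) := by
  have hS : Set.InjOn (castVec (dmod u x z + 1)) (Set.range (dpts u x z)) := castVec_injOn (dpts u x z)
  have key := torus_law (dmod u x z + 1) (castVec _ u) (castVec _ x, a) (castVec _ z, b)
  dsimp only at key
  have mx : x ∈ Set.range (dpts u x z) := ⟨Sum.inl (Sum.inl (true, true)), rfl⟩
  have mz : z ∈ Set.range (dpts u x z) := ⟨Sum.inl (Sum.inl (true, false)), rfl⟩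
  have mu : u ∈ Set.range (dpts u x z) := ⟨Sum.inl (Sum.inl (false, true)), rfl⟩
  have mα₁ : ∀ γ i, u - unitVec γ + wα unitVec γ i ∈ Set.range (dpts u x z) :=
    fun γ i => ⟨Sum.inl (Sum.inr ((γ, (true, true)), i)), rfl⟩
  have mβ₁ : ∀ γ i, u - unitVec γ + wβ unitVec γ i ∈ Set.range (dpts u x z) :=
    fun γ i => ⟨Sum.inl (Sum.inr ((γ, (true, false)), i)), rfl⟩
  have mα₂ : ∀ γ i, u + wα unitVec γ i ∈ Set.range (dpts u x z) := fun γ i => ⟨Sum.inl (Sum.inr ((γ, (false, true)), i)), rfl⟩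
  have mβ₂ : ∀ γ i, u + wβ unitVec γ i ∈ Set.range (dpts u x z) := fun γ i => ⟨Sum.inl (Sum.inr ((γ, (false, false)), i)), rfl⟩
  have m₃ : ∀ ν μ, z - unitVec ν + unitVec μ ∈ Set.range (dpts u x z) := fun ν μ => ⟨Sum.inr (Sum.inl (ν, μ)), rfl⟩
  have m₁ : ∀ ν, z - unitVec ν ∈ Set.range (dpts u x z) := fun ν => ⟨Sum.inr (Sum.inr (true, ν)), rfl⟩
  have m₂ : ∀ μ, z + unitVec μ ∈ Set.range (dpts u x z) := fun μ => ⟨Sum.inr (Sum.inr (false, μ)), rfl⟩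
  have hsub : ∀ γ, castVec (dmod u x z + 1) u - (⇑(castVec (dmod u x z + 1)) ∘ unitVec) γ = castVec (dmod u x z + 1) (u - unitVec γ) :=
    fun γ => by rw [Function.comp_apply, map_sub]
  have hγ : ∀ γ, S₀A (⇑(castVec (dmod u x z + 1)) ∘ unitVec) (castVec (dmod u x z + 1) (u - unitVec γ)) γ
      (castVec (dmod u x z + 1) x, a) (castVec (dmod u x z + 1) z, b) = S₀A unitVec (u - unitVec γ) γ (x, a) (z, b) :=
    fun γ => S₀A_map _ hS unitVec (u - unitVec γ) γ mx mz (mα₁ γ) (mβ₁ γ) a b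
  have hγ' : ∀ γ, S₀A (⇑(castVec (dmod u x z + 1)) ∘ unitVec) (castVec (dmod u x z + 1) u) γ
      (castVec (dmod u x z + 1) x, a) (castVec (dmod u x z + 1) z, b) = S₀A unitVec u γ (x, a) (z, b) :=
    fun γ => S₀A_map _ hS unitVec u γ mx mz (mα₂ γ) (mβ₂ γ) a b
  simp only [hsub, hγ, hγ', Lc_map _ hS unitVec b z x a mx mz m₁ m₂ m₃, hS.eq_iff mz mu, hS.eq_iff mx mu] at key
  exact key

end Transfer

/-! ## §3 The law for `wilsonA`: entrywise, and as a commutator with the diagonal generator -/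

section Law

/-- [folklore] **THE FIELD–FIELD ENTRY OF THE LAW**: `divV (wilsonA d) u x z (inl a) (inl b) = ½ · (d*d δ_{(b,z)})_a(x) · ([z = u] − [x = u])`. -/
theorem divV_wilsonA_inl_inl (u x z : Fin (d + 1) → ℤ) (a b : Fin (d + 1)) :
    divV (wilsonA d) u x z (Sum.inl a) (Sum.inl b) =
      (1 / 2 : ℝ) * curvAdj (curv (delta1 b z)) a x * ((if z = u then 1 else 0) - (if x = u then 1 else 0)) := by
  rw [divV_apply]
  simp only [wilsonA_inl_inl]
  rw [S₀A_div_Z, curvAdj_curv_delta1_symm a b x z, curvAdj_curv_delta1_eq_two_mul_Lc]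
  ring

/-- [folklore] the law's field–multiplier entries vanish (both sides). -/
theorem divV_wilsonA_inl_inr (u x z : Fin (d + 1) → ℤ) (a b : Fin (d + 1)) :
    divV (wilsonA d) u x z (Sum.inl a) (Sum.inr b) = 0 := by
  rw [divV_apply]
  simp only [wilsonA_inl_inr, sub_self, Finset.sum_const_zero]

/-- [folklore] the law's multiplier–field entries vanish. -/
theorem divV_wilsonA_inr_inl (u x z : Fin (d + 1) → ℤ) (a b : Fin (d + 1)) :
    divV (wilsonA d) u x z (Sum.inr a) (Sum.inl b) = 0 := by
  rw [divV_apply]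
  simp only [wilsonA_inr_inl, sub_self, Finset.sum_const_zero]

/-- [folklore] the law's multiplier–multiplier entries vanish. -/
theorem divV_wilsonA_inr_inr (u x z : Fin (d + 1) → ℤ) (a b : Fin (d + 1)) :
    divV (wilsonA d) u x z (Sum.inr a) (Sum.inr b) = 0 := by
  rw [divV_apply]
  simp only [wilsonA_inr_inr, sub_self, Finset.sum_const_zero]

/-- [folklore] **TRANSVERSALITY AWAY FROM THE LEGS**: if the varied site `u` is neither leg's site, the divergence entry vanishes. -/
theorem divV_wilsonA_eq_zero {u x z : Fin (d + 1) → ℤ} (hx : x ≠ u) (hz : z ≠ u) (a b : Fib d) :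
    divV (wilsonA d) u x z a b = 0 := by
  rcases a with a | a <;> rcases b with b | b
  · rw [divV_wilsonA_inl_inl, if_neg hz, if_neg hx, sub_self, mul_zero]
  · exact divV_wilsonA_inl_inr u x z a b
  · exact divV_wilsonA_inr_inl u x z a b
  · exact divV_wilsonA_inr_inr u x z a b

/-- [folklore] **HEADLINE — THE WARD (DIVERGENCE) LAW OF THE WILSON TABLE, COMMUTATOR FORM** (the (W-LS0-E) socket of the hW root with its
constant DECIDED BY THE KERNEL: `cE' = 1/2`): for every root `ρ`, window parameter `L` and site `u`,
`divV (wilsonA d) u = (1/2 : ℝ) • conjV (ffK (bhKAt d ρ L)) (diagK (legInd ρ u))`. -/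
theorem divV_wilsonA_eq_conjV (ρ : Fin (d + 1) → ℤ) (L : ℕ) (u : Fin (d + 1) → ℤ) :
    divV (wilsonA d) u = (1 / 2 : ℝ) • conjV (ffK (bhKAt d ρ L)) (diagK (legInd ρ u)) := by
  funext x z a b
  rw [Pi.smul_apply, Pi.smul_apply, Pi.smul_apply, Pi.smul_apply, smul_eq_mul]
  rcases a with a | a <;> rcases b with b | b
  · rw [divV_wilsonA_inl_inl, conjV_ffK_bhKAt_diagK_legInd_inl_inl, bhK_inl_inl_eq]
    ring
  · rw [divV_wilsonA_inl_inr, conjV_diagK_apply, ffK_inl_inr, zero_mul, mul_zero]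
  · rw [divV_wilsonA_inr_inl, conjV_diagK_apply, ffK_inr_inl, zero_mul, mul_zero]
  · rw [divV_wilsonA_inr_inr, conjV_diagK_apply, ffK_inr_inr, zero_mul, mul_zero]

/-- [folklore] **THE BLOCK (or any finitely smeared) FORM**: `Σ_{i ∈ s} divV (wilsonA d) (U i) = ½ • conjV (ffK (bhKAt d ρ L)) (diagK (Σ_{i ∈ s} legInd ρ (U i)))`
(the diagonal contact is additive in its symbol, `WardLocusS0N.conjV_diagK_sum`). -/
theorem sum_divV_wilsonA_eq_conjV {ι : Type*} (s : Finset ι) (U : ι → Fin (d + 1) → ℤ) (ρ : Fin (d + 1) → ℤ) (L : ℕ) :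
    ∑ i ∈ s, divV (wilsonA d) (U i) = (1 / 2 : ℝ) • conjV (ffK (bhKAt d ρ L)) (diagK (∑ i ∈ s, legInd ρ (U i))) := by
  rw [conjV_diagK_sum, Finset.smul_sum]
  exact Finset.sum_congr rfl fun i _ => divV_wilsonA_eq_conjV ρ L (U i)

end Law

/-! ## §4 The block stencil Ward socket `hSd` of the hW root at `j = 0` -/

section Socket

variable {Lc : ℕ} [NeZero Lc]

/-- [folklore] **`hSd` AT `j = 0` ON THE LOCK LOCUS.**  With the Wilson Ward law supplied (constant `1/2`), leaf-10's
`WardLocusS0N.hSd_S0NAt_of_wilsonWard` gives the socket `hSd` of `KernelWardRelative.wardTransversal_flipK_hessKer_conj_rel` for the rooted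
native spine `S0NAt ρ cE cVH cΛ`, `𝕄₀ = bhKAt d ρ Lc`, generator `ξ • Σ_v legInd ρ (Lc•y + v)`, for every `(cE, cVH, cH, ξ)` with
`cH·cE/2 = ξ` and `cH·cVH = −ξ·Lc^{d+1}` (in-block root `ρ = toSite r`). -/
theorem hSd_S0NAt_of_lock (hLc : 1 ≤ Lc) {r : Fin (d + 1) → ℕ} (hr : r ∈ box (d + 1) Lc) {cE cVH cΛ cH ξ : ℝ}
    (h₁ : cH * cE * (1 / 2) = ξ) (h₂ : cH * cVH = -(ξ * (Lc : ℝ) ^ (d + 1))) (y : Fin (d + 1) → ℤ) :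
    cH • ∑ v ∈ box (d + 1) Lc, divV (S0NAt d Lc (toSite r) cE cVH cΛ) ((Lc : ℤ) • y + toSite v) =
      conjV (bhKAt d (toSite r) Lc) (diagK (ξ • ∑ v ∈ box (d + 1) Lc, legInd (toSite r) ((Lc : ℤ) • y + toSite v))) :=
  hSd_S0NAt_of_wilsonWard hLc hr (fun u => divV_wilsonA_eq_conjV (toSite r) Lc u) h₁ h₂ y

/-- [folklore] **`hSd` AT `j = 0` AT THE hR UNITS FOLD `(cE, cVH) = (2, −Lc^{d+1})`** (R45 / the lock `WardLocusS0N.lock_at_units_fold`): for every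
`ξ`, every Λ-weight `cΛ` and every in-block root, with `cH = ξ`,
`ξ • Σ_{v ∈ box} divV (S0NAt ρ 2 (−Lc^{d+1}) cΛ) (Lc•y + v) = conjV (bhKAt d ρ Lc) (diagK (ξ • Σ_v legInd ρ (Lc•y + v)))` — the block stencil Ward socket of the
hW root holds at `j = 0` for the units-fold spine, with NO remaining hypothesis. -/
theorem hSd_S0NAt_units_fold (hLc : 1 ≤ Lc) {r : Fin (d + 1) → ℕ} (hr : r ∈ box (d + 1) Lc) (cΛ ξ : ℝ) (y : Fin (d + 1) → ℤ) :
    ξ • ∑ v ∈ box (d + 1) Lc, divV (S0NAt d Lc (toSite r) 2 (-((Lc : ℝ) ^ (d + 1))) cΛ) ((Lc : ℤ) • y + toSite v) =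
      conjV (bhKAt d (toSite r) Lc) (diagK (ξ • ∑ v ∈ box (d + 1) Lc, legInd (toSite r) ((Lc : ℤ) • y + toSite v))) :=
  hSd_S0NAt_of_lock hLc hr (cE := 2) (cVH := -((Lc : ℝ) ^ (d + 1))) (cH := ξ) (ξ := ξ) (by ring) (by ring) y

end Socket

end

end Summit.QuantumFields.BalabanUV.Beta.WilsonDivergenceContact
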